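import Summits.QuantumFields.BalabanUV.Beta.GAN24.ContactLambdaCellBound
import Summits.QuantumFields.BalabanUV.Beta.GAN24.ContactGaugeStaircaseLocal
import Summits.QuantumFields.BalabanUV.Beta.GAN24.ContactLambdaCellFactorised
import Summits.QuantumFields.BalabanUV.Beta.GAN24.Push3BorderGaugeSlotCells

/-!
# `GAN24.ContactLambdaEntryBound` — CT-ROUTE, the row owner's `gen20/BORNSEC-PLAN-v1.md` v1.1 §0 (c)∕§0′ ∕ §A (Λ-C) **(C4) PART 3: THE ENTRY BOUND OF THE Λ CONTACT
# DIFFERENCE FROM LETTERS** (generic `d`) — leaf-02 g48's factorised socket `ContactLambdaCellFactorised.contact_lambda_eq_factorised` at `lᴱ = rᴱ = wᴱ = T`, `lᴮ = rᴮ = wᴮ = B`,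
# `T − B = dz λ`, the dressed leg of the first cell SPLIT `T = B + dz λ` (the owner's §0′ «the dressed leg's `N^{−D}` sup never meets `Δ_a`»), and the three resulting cells
# (mixed ∕ ΔΔ ∕ mixed) counted by PART 1 `ContactLambdaCellBound.abs_sum_tsum_mul_le_of_env3` with PART 2's localised gauge letters: for EVERY coefficient family under its
# decay ∕ transversality ∕ BRACKET letters, every pair of legs under a block envelope, every gauge staircase under geometric localised letters,
# `|push₃ T T T (SLam Lc c H_ρ) κ′u′ x′z′ (inl α) (inl β) − push₃ B B B (SLam Lc c H_ρ) κ′u′ x′z′ (inl α) (inl β)| ≤ (2Lc^{d+1})⁻¹·(d+1)·T_b·(Lc^n)^{d+1}·Zl·e^{4(d+1)κ}·Cnt·(2·K_B·α_g·(4 + 2Lc·n) + α_g²·(8 + 12·Lc·n))·e^{−(κ∕12)(‖x′−u′‖∞ + ‖z′−u′‖∞)}`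
# (OWNER gan24-p1-g21 [GAN24P1-G21-ONLINE] (W1) «(C4) IS YOURS»; journal `CLAIMS.log` l.34168 ∕ l.34465)

HONEST FRAMING (cell charter, verbatim): «discharging `BetaPertH` makes Bałaban's UV stability UNCONDITIONAL — a real constructive-QFT result;
it is NOT the continuum limit and NOT the Clay problem.»  DERIVED cell leaf (pub-balaban, G-an2-4 formalisation swarm → CRUX TEAM (2), seat
`b2b-balaban-gan24-formalise-leaf-02`, gen 49): [folklore] bookkeeping over this lineage's `ContactLambdaCellFactorised` ∕ `ContactLambdaCellBound` ∕ `ContactGaugeStaircaseLocal`,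
leaf-01's `ContactFaceJumpCommutator.commutator_eq_sum` ∕ `sum_abs_linCountAt_le`, `Push3LegTelescope.abs_le_of_env' ∕ summable_of_env'` and `Push3BorderGaugeSlotCells.card_nearBox`
BY NAME; generic `d`; every analytic input a LETTER; NO cited fact, NO `def`, NO `def … : Prop`, NO sorry, NO wall binder.  Discharges NO letter of (CONV-C) by itself (the `d = 3`
instance with the tree's letters and the unit count is PARTS 4–5 `BornLambdaContactLineage` ∕ `BornLambdaContactBound`); NEVER «G-an2-4 closed»; NOT hS0, NOT D1, NOT `BetaPertH`, NOT continuum, NOT Clay.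
HONEST DEPENDENCY (cell records, verbatim): «continuum YM on T⁴ ⇐ BetaPertH ∧ nine spine estimates (0/9 proved); BetaPertH ⇐ (D1) ∧ (D4) ∧ CAP+tail;
G-an2-4 gates asym, D1 and NE2/3/4.»
ABSOLUTE RULE (cell charter, verbatim): «No internally-minted statement may enter as a cited fact. Every hypothesis is either kernel-proved in this
package or a verbatim quotation of a PUBLISHED theorem with page reference. The manuscript(s) under audit are NOT citable for their own disputed steps —
they are the thing under adjudication; programme-internal (2001/route/tribunal) claims are never citable.»

## What is proved (generic `d`, `1 ≤ Lc`, box root `ρ = toSite rr`; relative blocking `Lc^{n+1}` (legs, gauge pieces) ∕ `Lc^n` (tent); ONE rate `κ > 0`;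
## `E₀ := e^{2(d+1)κ}`, `Cnt := (2Lc)^{d+1}·((d+1)·(Lc^{d+1}·ell (d+1) Lc))`)
* §1 `sum_abs_linCountAt_le_cnt` (the count constant), `mul_sum_ite` (a scalar into the face letter).
* §2 **`abs_sum_tsum_mixed_le`** — THE MIXED CELL: a gauge staircase `ψ` with pieces under `α_g·Lc^s·e^{−κ‖quo (Lc^{n+1}) u − x_g‖∞}`, a leg `|R a x| ≤ K_B·e^{−κ‖quo (Lc^{n+1}) x − x_l‖∞}`,
  brackets `|b μ y| ≤ T_b·e^{−κ‖quo (Lc^n) y − u′‖∞}` ⇒ summable and `|Σ_μ Σ'_y b μ y·[𝒬^ρ_{Lc}, ψ̄]R (μ,y)| ≤ (d+1)·T_b·(E₀²·K_B·Cnt)·(4α_g + 2α_g·Lc·n)·((Lc^n)^{d+1}·Zl)·e^{−(κ∕12)(‖x_g−u′‖∞+‖x_l−u′‖∞)}`.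
* §3 **`abs_sum_tsum_dz_le`** — THE ΔΔ CELL: two staircases (sources `x_g`, `x_l`) ⇒ `≤ (d+1)·T_b·(E₀²·Cnt)·(8α_g² + 2·(6α_g²)·Lc·n)·((Lc^n)^{d+1}·Zl)·e^{−(κ∕12)(…)}`.
* §4 **`abs_contact_entry_le`** — THE ENTRY BOUND displayed in the title: socket → split → §2 + §3 + §2.
NOT HERE: the letters at `d = 3` (p2 g33 `BornLambdaBracketLetter`, (N1), `ContactGaugeStaircase.abs_gaugePiece_le`, `BornLambdaContactCells` §1) and the unit count → `hCg` (PARTS 4–5).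
Provenance: seat b2b-balaban-gan24-formalise-leaf-02 gen 49 (prover-…-leaf-02-g49-0), 2026-08-21; over the files named above BY NAME.
-/

noncomputable section

open Finset
open scoped BigOperators
open Literature.MathematicalPhysics.QuantumFieldTheory
open Literature.MathematicalPhysics.QuantumFieldTheory.LatticeForm (quo)
open Literature.MathematicalPhysics.QuantumFieldTheory.Balaban1983to89
open Literature.MathematicalPhysics.QuantumFieldTheory.Balaban1983to89.Beta
open B4ContourShift (supNorm supNorm_nonneg)
open B12Sec2to5 (l1 l1_nonneg)
open ExpKernelCalculus (Zl Zl_nonneg)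
open AffineAveraging (Form0 Form1 Site box toSite unitVec dz)
open AveragingContours (blk)
open AveragingContoursRooted (linAvgAt)
open AveragingHessianKernels (ell)
open AveragingHessianKernelsRooted (linCountAt hessFFAt)
open InterLevelTransport (SLam)
open KernelWard (divV)
open Summit.QuantumFields.BalabanUV.Beta.LinearGaugeVH (nearBox mem_nearBox)
open Summit.QuantumFields.BalabanUV.Beta.GAN24.Push3 (push₃)
open Summit.QuantumFields.BalabanUV.Beta.GAN24.Push3LegTelescope (abs_le_of_env' summable_of_env')
open Summit.QuantumFields.BalabanUV.Beta.GAN24.Push3BorderGaugeSlotCells (card_nearBox)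
open Summit.QuantumFields.BalabanUV.Beta.GAN24.ContactFaceJumpCommutator (commutator_eq_sum sum_abs_linCountAt_le)
open Summit.QuantumFields.BalabanUV.Beta.GAN24.ContactLambdaCellFactorised (contact_lambda_eq_factorised)
open Summit.QuantumFields.BalabanUV.Beta.GAN24.ContactLambdaCellBound (abs_commutator_le_of_staircase_of_env abs_commutator_dz_le_of_staircase_of_env
  abs_sum_tsum_mul_le_of_env3)
open Summit.QuantumFields.BalabanUV.Beta.GAN24.ContactGaugeStaircaseLocal (env_label_le corner_le_of_mem_nearBox abs_weight_finest_le_env abs_dz_finest_le_env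
  sum_abs_jump_le_env)

namespace Summit.QuantumFields.BalabanUV.Beta.GAN24.ContactLambdaEntryBound

variable {d : ℕ} {Lc : ℕ} {rr : Fin (d + 1) → ℕ}

/-! ## §1 The count constant and a scalar into the face letter -/

/-- [folklore] **THE COUNT CONSTANT** (leaf-01's `sum_abs_linCountAt_le` × `card_nearBox`): `Σ_{x ∈ nearBox Lc y} Σ_α |linCountAt ρ Lc μ y (α,x)| ≤ (2Lc)^{d+1}·((d+1)·(Lc^{d+1}·ell (d+1) Lc))`. -/
theorem sum_abs_linCountAt_le_cnt (hLc : 1 ≤ Lc) (hrr : rr ∈ box (d + 1) Lc) (μ : Fin (d + 1)) (y : Site (d + 1)) :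
    ∑ x ∈ nearBox Lc y, ∑ α, |(linCountAt (toSite rr) Lc μ y (α, x) : ℝ)|
      ≤ ((2 * Lc : ℕ) : ℝ) ^ (d + 1) * (((d + 1 : ℕ) : ℝ) * ((Lc : ℝ) ^ (d + 1) * (ell (d + 1) Lc : ℝ))) := by
  have h := sum_abs_linCountAt_le hLc hrr μ y
  rw [card_nearBox] at h
  exact_mod_cast h

/-- [folklore] A nonnegative... any scalar enters the face letter: `c·Σ_s [P s]·(2·a s) = Σ_s [P s]·(2·(c·a s))`. -/
theorem mul_sum_ite (S : Finset ℕ) (P : ℕ → Prop) [DecidablePred P] (a : ℕ → ℝ) (c : ℝ) :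
    c * ∑ s ∈ S, (if P s then 2 * a s else 0) = ∑ s ∈ S, (if P s then 2 * (c * a s) else 0) := by
  rw [Finset.mul_sum]
  refine Finset.sum_congr rfl fun s _ => ?_
  split_ifs <;> ring

/-! ## §2 The mixed cell -/

section Mixed

variable {n : ℕ} {κ αg KB Tb : ℝ} {Gs : ℕ → Site (d + 1) → ℝ} {ψ : Site (d + 1) → ℝ} {R : Form1 (d + 1) ℝ}
  {b : Fin (d + 1) → Site (d + 1) → ℝ} {xg xl u' : Site (d + 1)}

/-- NOT IN PRINT; OUR BOOKKEEPING ([folklore]; BORNSEC-PLAN v1.1 §0 (c) for ONE mixed cell, every input a letter).  **THE MIXED CELL**: brackets under the tent letter at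
blocking `Lc^n` and label `u′`, a gauge staircase `ψ = Σ_{s<n+1} G s ∘ blk (Lc^s)` with localised geometric pieces (source label `x_g`), a leg under a block envelope (label `x_l`):
`|Σ_μ Σ'_y b μ y·[𝒬^ρ_{Lc}, ψ̄]R (μ,y)| ≤ (d+1)·T_b·(E₀²·K_B·Cnt)·(4α_g + 2·α_g·Lc·n)·((Lc^n)^{d+1}·Zl(κ∕(4(d+1))))·e^{−(κ∕12)(‖x_g − u′‖∞ + ‖x_l − u′‖∞)}` and every `y`-family is summable. -/
theorem abs_sum_tsum_mixed_le (hLc : 1 ≤ Lc) (hrr : rr ∈ box (d + 1) Lc) (hκ : 0 < κ) (hαg : 0 ≤ αg) (hKB : 0 ≤ KB) (hTb : 0 ≤ Tb)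
    (hψ : ∀ u, ψ u = ∑ s ∈ Finset.range (n + 1), Gs s (blk (Lc ^ s) u))
    (hG : ∀ s, s ≤ n → ∀ u, |Gs s (blk (Lc ^ s) u)| ≤ αg * (Lc : ℝ) ^ s * Real.exp (-(κ * supNorm (quo (Lc ^ (n + 1)) u - xg))))
    (hR : ∀ a x, |R a x| ≤ KB * Real.exp (-(κ * supNorm (quo (Lc ^ (n + 1)) x - xl))))
    (hb : ∀ μ y, |b μ y| ≤ Tb * Real.exp (-(κ * supNorm (quo (Lc ^ n) y - u')))) :
    (∀ μ, Summable fun y : Site (d + 1) => b μ y *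
        (linAvgAt (toSite rr) (fun a x => (ψ x + ψ (x + unitVec a)) * R a x) Lc μ y
          - (ψ ((Lc : ℤ) • y + toSite rr) + ψ ((Lc : ℤ) • y + toSite rr + (Lc : ℤ) • unitVec μ)) * linAvgAt (toSite rr) R Lc μ y)) ∧
    |∑ μ, ∑' y : Site (d + 1), b μ y *
        (linAvgAt (toSite rr) (fun a x => (ψ x + ψ (x + unitVec a)) * R a x) Lc μ y
          - (ψ ((Lc : ℤ) • y + toSite rr) + ψ ((Lc : ℤ) • y + toSite rr + (Lc : ℤ) • unitVec μ)) * linAvgAt (toSite rr) R Lc μ y)|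
      ≤ ((d : ℝ) + 1) * Tb * (Real.exp (2 * ((d : ℝ) + 1) * κ) ^ 2 * KB *
            (((2 * Lc : ℕ) : ℝ) ^ (d + 1) * (((d + 1 : ℕ) : ℝ) * ((Lc : ℝ) ^ (d + 1) * (ell (d + 1) Lc : ℝ)))))
          * (4 * αg + 2 * αg * Lc * n) * ((((Lc ^ n : ℕ) : ℝ)) ^ (d + 1) * Zl (d + 1) (κ / (4 * ((d : ℝ) + 1)))) *
          Real.exp (-(κ / 12) * (supNorm (xg - u') + supNorm (xl - u'))) := by
  set E₀ : ℝ := Real.exp (2 * ((d : ℝ) + 1) * κ) with hE₀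
  set Cnt : ℝ := ((2 * Lc : ℕ) : ℝ) ^ (d + 1) * (((d + 1 : ℕ) : ℝ) * ((Lc : ℝ) ^ (d + 1) * (ell (d + 1) Lc : ℝ))) with hCnt
  have hE₀0 : 0 ≤ E₀ := (Real.exp_pos _).le
  have hLn : 1 ≤ Lc ^ n := Nat.one_le_pow _ _ hLc
  -- the commutator letter of PART 1 §3 with PART 2's localised gauge letters and the leg envelope moved to the bond's label
  have hc : ∀ μ y, |linAvgAt (toSite rr) (fun a x => (ψ x + ψ (x + unitVec a)) * R a x) Lc μ y
        - (ψ ((Lc : ℤ) • y + toSite rr) + ψ ((Lc : ℤ) • y + toSite rr + (Lc : ℤ) • unitVec μ)) * linAvgAt (toSite rr) R Lc μ y|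
      ≤ (4 * αg + ∑ s ∈ Finset.range n, (if (Lc : ℤ) ^ s ∣ y μ + 1 then 2 * ((fun m => αg * (Lc : ℝ) ^ m) (s + 1)) else 0)) *
        ((E₀ ^ 2 * KB * Cnt) * Real.exp (-(κ * supNorm (quo (Lc ^ n) y - xg))) * Real.exp (-(κ * supNorm (quo (Lc ^ n) y - xl)))) := by
    intro μ y
    have hW := fun a x (hx : x ∈ nearBox Lc y) => abs_weight_finest_le_env hLc hκ.le hαg hG hrr μ y a hx
    have hJ := sum_abs_jump_le_env hLc hκ.le hαg hG μ y
    have hB : ∀ a, ∀ x ∈ nearBox Lc y, |R a x| ≤ KB * (E₀ * Real.exp (-(κ * supNorm (quo (Lc ^ n) y - xl)))) := fun a x hx =>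
      (hR a x).trans (mul_le_mul_of_nonneg_left (env_label_le hLc hκ.le n xl (corner_le_of_mem_nearBox hx)) hKB)
    have h := abs_commutator_le_of_staircase_of_env hLc hrr Gs n hψ R μ y (W₀ := 4 * αg)
      (F := ∑ s ∈ Finset.range n, (if (Lc : ℤ) ^ s ∣ y μ + 1 then 2 * (αg * (Lc : ℝ) ^ (s + 1)) else 0))
      (E := E₀ * Real.exp (-(κ * supNorm (quo (Lc ^ n) y - xg)))) (M := KB * (E₀ * Real.exp (-(κ * supNorm (quo (Lc ^ n) y - xl)))))
      (by positivity) (by positivity) (by positivity) hW hJ hB (sum_abs_linCountAt_le_cnt hLc hrr μ y)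
    refine h.trans (le_of_eq ?_)
    simp only []
    ring
  have ha : ∀ s, s < n → 0 ≤ (fun m => αg * (Lc : ℝ) ^ m) (s + 1) ∧ (fun m => αg * (Lc : ℝ) ^ m) (s + 1) ≤ αg * (Lc : ℝ) ^ (s + 1) :=
    fun s _ => ⟨by positivity, le_rfl⟩
  exact abs_sum_tsum_mul_le_of_env3 (d := d) (Lc := Lc) (M := Lc ^ n) (n := n) hLc hLn (fun s hs => pow_dvd_pow Lc hs.le) hκ
    (a := fun m => αg * (Lc : ℝ) ^ m) ha (b := b)
    (c := fun μ y => linAvgAt (toSite rr) (fun a x => (ψ x + ψ (x + unitVec a)) * R a x) Lc μ y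
          - (ψ ((Lc : ℤ) • y + toSite rr) + ψ ((Lc : ℤ) • y + toSite rr + (Lc : ℤ) • unitVec μ)) * linAvgAt (toSite rr) R Lc μ y)
    hTb (by positivity : 0 ≤ E₀ ^ 2 * KB * Cnt) (by positivity : (0 : ℝ) ≤ 4 * αg) u' xg xl hb hc

end Mixed

/-! ## §3 The ΔΔ cell -/

section DeltaDelta

variable {n : ℕ} {κ αg Tb : ℝ} {Ga Gb : ℕ → Site (d + 1) → ℝ} {ψa ψb : Site (d + 1) → ℝ}
  {b : Fin (d + 1) → Site (d + 1) → ℝ} {xg xl u' : Site (d + 1)}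

/-- NOT IN PRINT; OUR BOOKKEEPING ([folklore]; BORNSEC-PLAN v1.1 §0′ for ONE ΔΔ cell).  **THE ΔΔ CELL**: two gauge staircases with localised geometric pieces of the same letter
`α_g` (sources `x_g`, `x_l`), brackets under the tent letter:
`|Σ_μ Σ'_y b μ y·[𝒬^ρ_{Lc}, ψ̄_a](dz ψ_b)(μ,y)| ≤ (d+1)·T_b·(E₀²·Cnt)·(8α_g² + 2·(6α_g²)·Lc·n)·((Lc^n)^{d+1}·Zl)·e^{−(κ∕12)(‖x_g − u′‖∞ + ‖x_l − u′‖∞)}` and every `y`-family is summable. -/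
theorem abs_sum_tsum_dz_le (hLc : 1 ≤ Lc) (hrr : rr ∈ box (d + 1) Lc) (hκ : 0 < κ) (hαg : 0 ≤ αg) (hTb : 0 ≤ Tb)
    (hψa : ∀ u, ψa u = ∑ s ∈ Finset.range (n + 1), Ga s (blk (Lc ^ s) u))
    (hψb : ∀ u, ψb u = ∑ s ∈ Finset.range (n + 1), Gb s (blk (Lc ^ s) u))
    (hGa : ∀ s, s ≤ n → ∀ u, |Ga s (blk (Lc ^ s) u)| ≤ αg * (Lc : ℝ) ^ s * Real.exp (-(κ * supNorm (quo (Lc ^ (n + 1)) u - xg))))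
    (hGb : ∀ s, s ≤ n → ∀ u, |Gb s (blk (Lc ^ s) u)| ≤ αg * (Lc : ℝ) ^ s * Real.exp (-(κ * supNorm (quo (Lc ^ (n + 1)) u - xl))))
    (hb : ∀ μ y, |b μ y| ≤ Tb * Real.exp (-(κ * supNorm (quo (Lc ^ n) y - u')))) :
    (∀ μ, Summable fun y : Site (d + 1) => b μ y *
        (linAvgAt (toSite rr) (fun a x => (ψa x + ψa (x + unitVec a)) * dz ψb a x) Lc μ y
          - (ψa ((Lc : ℤ) • y + toSite rr) + ψa ((Lc : ℤ) • y + toSite rr + (Lc : ℤ) • unitVec μ)) * linAvgAt (toSite rr) (dz ψb) Lc μ y)) ∧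
    |∑ μ, ∑' y : Site (d + 1), b μ y *
        (linAvgAt (toSite rr) (fun a x => (ψa x + ψa (x + unitVec a)) * dz ψb a x) Lc μ y
          - (ψa ((Lc : ℤ) • y + toSite rr) + ψa ((Lc : ℤ) • y + toSite rr + (Lc : ℤ) • unitVec μ)) * linAvgAt (toSite rr) (dz ψb) Lc μ y)|
      ≤ ((d : ℝ) + 1) * Tb * (Real.exp (2 * ((d : ℝ) + 1) * κ) ^ 2 *
            (((2 * Lc : ℕ) : ℝ) ^ (d + 1) * (((d + 1 : ℕ) : ℝ) * ((Lc : ℝ) ^ (d + 1) * (ell (d + 1) Lc : ℝ)))))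
          * (8 * αg ^ 2 + 2 * (6 * αg ^ 2) * Lc * n) * ((((Lc ^ n : ℕ) : ℝ)) ^ (d + 1) * Zl (d + 1) (κ / (4 * ((d : ℝ) + 1)))) *
          Real.exp (-(κ / 12) * (supNorm (xg - u') + supNorm (xl - u'))) := by
  set E₀ : ℝ := Real.exp (2 * ((d : ℝ) + 1) * κ) with hE₀
  set Cnt : ℝ := ((2 * Lc : ℕ) : ℝ) ^ (d + 1) * (((d + 1 : ℕ) : ℝ) * ((Lc : ℝ) ^ (d + 1) * (ell (d + 1) Lc : ℝ))) with hCnt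
  have hE₀0 : 0 ≤ E₀ := (Real.exp_pos _).le
  have hLn : 1 ≤ Lc ^ n := Nat.one_le_pow _ _ hLc
  have hc : ∀ μ y, |linAvgAt (toSite rr) (fun a x => (ψa x + ψa (x + unitVec a)) * dz ψb a x) Lc μ y
        - (ψa ((Lc : ℤ) • y + toSite rr) + ψa ((Lc : ℤ) • y + toSite rr + (Lc : ℤ) • unitVec μ)) * linAvgAt (toSite rr) (dz ψb) Lc μ y|
      ≤ (8 * αg ^ 2 + ∑ s ∈ Finset.range n, (if (Lc : ℤ) ^ s ∣ y μ + 1 then 2 * ((fun m => 6 * αg * (αg * (Lc : ℝ) ^ m)) (s + 1)) else 0)) *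
        ((E₀ ^ 2 * Cnt) * Real.exp (-(κ * supNorm (quo (Lc ^ n) y - xg))) * Real.exp (-(κ * supNorm (quo (Lc ^ n) y - xl)))) := by
    intro μ y
    classical
    have hWa := fun a x (hx : x ∈ nearBox Lc y) => abs_weight_finest_le_env hLc hκ.le hαg hGa hrr μ y a hx
    have hgb := fun a x (hx : x ∈ nearBox Lc y) => abs_dz_finest_le_env hLc hκ.le hαg hGb y a hx
    have hJa := sum_abs_jump_le_env hLc hκ.le hαg hGa μ y
    have hJb := sum_abs_jump_le_env hLc hκ.le hαg hGb μ y
    have h := abs_commutator_dz_le_of_staircase_of_env hLc hrr Ga Gb n hψa hψb μ y (Wa := 4 * αg) (gb := 2 * αg)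
      (F := ∑ s ∈ Finset.range n, (if (Lc : ℤ) ^ s ∣ y μ + 1 then 2 * (αg * (Lc : ℝ) ^ (s + 1)) else 0))
      (Ea := E₀ * Real.exp (-(κ * supNorm (quo (Lc ^ n) y - xg)))) (Eb := E₀ * Real.exp (-(κ * supNorm (quo (Lc ^ n) y - xl))))
      (by positivity) (by positivity) (by positivity) (by positivity) hWa hgb hJa hJb (sum_abs_linCountAt_le_cnt hLc hrr μ y)
    refine h.trans (le_of_eq ?_)
    rw [show (4 * αg + 2 * αg) * ∑ s ∈ Finset.range n, (if (Lc : ℤ) ^ s ∣ y μ + 1 then 2 * (αg * (Lc : ℝ) ^ (s + 1)) else 0)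
      = ∑ s ∈ Finset.range n, (if (Lc : ℤ) ^ s ∣ y μ + 1 then 2 * ((fun m => 6 * αg * (αg * (Lc : ℝ) ^ m)) (s + 1)) else 0) by
        rw [show (4 * αg + 2 * αg) = 6 * αg by ring, mul_sum_ite]]
    ring
  have ha : ∀ s, s < n → 0 ≤ (fun m => 6 * αg * (αg * (Lc : ℝ) ^ m)) (s + 1) ∧
      (fun m => 6 * αg * (αg * (Lc : ℝ) ^ m)) (s + 1) ≤ (6 * αg ^ 2) * (Lc : ℝ) ^ (s + 1) :=
    fun s _ => ⟨by positivity, le_of_eq (by simp only []; ring)⟩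
  exact abs_sum_tsum_mul_le_of_env3 (d := d) (Lc := Lc) (M := Lc ^ n) (n := n) hLc hLn (fun s hs => pow_dvd_pow Lc hs.le) hκ
    (a := fun m => 6 * αg * (αg * (Lc : ℝ) ^ m)) ha (b := b)
    (c := fun μ y => linAvgAt (toSite rr) (fun a x => (ψa x + ψa (x + unitVec a)) * dz ψb a x) Lc μ y
          - (ψa ((Lc : ℤ) • y + toSite rr) + ψa ((Lc : ℤ) • y + toSite rr + (Lc : ℤ) • unitVec μ)) * linAvgAt (toSite rr) (dz ψb) Lc μ y)
    hTb (by positivity : 0 ≤ E₀ ^ 2 * Cnt) (by positivity : (0 : ℝ) ≤ 8 * αg ^ 2) u' xg xl hb hc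

end DeltaDelta


/-! ## §4 The entry bound of the Λ contact difference -/

section Entry

variable {n : ℕ} {κ αg KB CT Clam Tb Cc δc : ℝ}
  {T B : Fin (d + 1) → (Fin (d + 1) → ℤ) → Fin (d + 1) → (Fin (d + 1) → ℤ) → ℝ}
  {lam : Fin (d + 1) → (Fin (d + 1) → ℤ) → (Fin (d + 1) → ℤ) → ℝ}
  {G : Fin (d + 1) → (Fin (d + 1) → ℤ) → ℕ → Site (d + 1) → ℝ}
  {c : Fin (d + 1) → (Fin (d + 1) → ℤ) → Fin (d + 1) → (Fin (d + 1) → ℤ) → ℝ}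

/-- NOT IN PRINT; OUR BOOKKEEPING ([folklore]; BORNSEC-PLAN v1.1 §0 (c) + §0′ per lineage, every analytic input a LETTER).  **THE ENTRY BOUND OF THE Λ CONTACT DIFFERENCE.**
Legs `T` (dressed: bounded with summable fine slices) and `B` (undressed: block envelope `K_B·e^{−κ‖quo (Lc^{n+1}) u − z‖∞}`) with `T − B = dz λ`, the bond gauge functions
`λ_{μ₀z₀}` staircases of depth `n+1` with localised geometric pieces (`α_g·Lc^s`, source label `z₀`), a coefficient family `c` under its decay ∕ transversality letters and the
BRACKET (tent) letter `|⟨T(κ′u′;·), c(μ,y;·)⟩| ≤ T_b·e^{−κ‖quo (Lc^n) y − u′‖∞}`.  THEN for all `κ′ u′ x′ z′ α β`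
`|push₃ T T T (SLam Lc c H_ρ) κ′u′ x′z′ (inl α)(inl β) − push₃ B B B (SLam Lc c H_ρ) κ′u′ x′z′ (inl α)(inl β)|`
`≤ (2Lc^{d+1})⁻¹·((d+1)·T_b·(E₀²·Cnt))·(2·K_B·(4α_g + 2α_g·Lc·n) + (8α_g² + 12α_g²·Lc·n))·((Lc^n)^{d+1}·Zl(κ∕(4(d+1))))·e^{−(κ∕12)(‖x′−u′‖∞ + ‖z′−u′‖∞)}`
— the socket `contact_lambda_eq_factorised`, the split `T = B + dz λ` of the first cell's leg (`commutator_eq_sum` is linear in the 1-form), §2 twice and §3 once. -/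
theorem abs_contact_entry_le (hLc : 1 ≤ Lc) (hrr : rr ∈ box (d + 1) Lc) (hκ : 0 < κ) (hαg : 0 ≤ αg) (hKB : 0 ≤ KB) (hTb : 0 ≤ Tb)
    (hc : ∀ μ y κ u, |c μ y κ u| ≤ Cc * Real.exp (-δc * l1 ((Lc : ℤ) • y - u))) (hδc : 0 < δc) (hCc : 0 ≤ Cc)
    (hdiv : ∀ u, divV (SLam Lc c (fun μ y => hessFFAt (toSite rr) Lc μ y)) u = 0)
    (hT : ∀ μ z κ u, |T μ z κ u| ≤ CT) (hTs : ∀ μ z κ, Summable fun u => T μ z κ u)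
    (hB : ∀ μ z l u, |B μ z l u| ≤ KB * Real.exp (-(κ * supNorm (quo (Lc ^ (n + 1)) u - z))))
    (hTB : T - B = fun μ z κ u => dz (lam μ z) κ u) (hlam : ∀ μ z u, |lam μ z u| ≤ Clam)
    (hψ : ∀ μ₀ z₀ u, lam μ₀ z₀ u = ∑ s ∈ Finset.range (n + 1), G μ₀ z₀ s (blk (Lc ^ s) u))
    (hG : ∀ μ₀ z₀ s, s ≤ n → ∀ u, |G μ₀ z₀ s (blk (Lc ^ s) u)| ≤ αg * (Lc : ℝ) ^ s * Real.exp (-(κ * supNorm (quo (Lc ^ (n + 1)) u - z₀))))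
    (hbr : ∀ (κ' : Fin (d + 1)) (u' : Site (d + 1)) μ y,
      |∑' u, ∑ κ, T κ' u' κ u * c μ y κ u| ≤ Tb * Real.exp (-(κ * supNorm (quo (Lc ^ n) y - u'))))
    (κ' : Fin (d + 1)) (u' x' z' : Site (d + 1)) (α β : Fin (d + 1)) :
    |push₃ T T T (SLam Lc c (fun μ y => hessFFAt (toSite rr) Lc μ y)) κ' u' x' z' (Sum.inl α) (Sum.inl β)
        - push₃ B B B (SLam Lc c (fun μ y => hessFFAt (toSite rr) Lc μ y)) κ' u' x' z' (Sum.inl α) (Sum.inl β)|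
      ≤ (2 * (Lc : ℝ) ^ (d + 1))⁻¹ *
          ((((d : ℝ) + 1) * Tb * (Real.exp (2 * ((d : ℝ) + 1) * κ) ^ 2 *
              (((2 * Lc : ℕ) : ℝ) ^ (d + 1) * (((d + 1 : ℕ) : ℝ) * ((Lc : ℝ) ^ (d + 1) * (ell (d + 1) Lc : ℝ))))))
            * (2 * KB * (4 * αg + 2 * αg * Lc * n) + (8 * αg ^ 2 + 2 * (6 * αg ^ 2) * Lc * n))
            * ((((Lc ^ n : ℕ) : ℝ)) ^ (d + 1) * Zl (d + 1) (κ / (4 * ((d : ℝ) + 1))))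
            * Real.exp (-(κ / 12) * (supNorm (x' - u') + supNorm (z' - u')))) := by
  -- the leg class of `B` and the socket
  have hLn1 : 1 ≤ Lc ^ (n + 1) := Nat.one_le_pow _ _ hLc
  have hBb : ∀ μ z l u, |B μ z l u| ≤ KB := abs_le_of_env' hκ.le hB
  have hBs : ∀ μ z l, Summable fun u => B μ z l u := summable_of_env' hLn1 hκ hB
  rw [contact_lambda_eq_factorised hLc hrr hc hδc hCc hdiv hT hTs hBb hBs hT hTs hBb hBs hT hBb hTB hTB hTB hlam κ' u' x' z' α β]
  -- the split of the first cell's leg `T β z′ = B β z′ + dz (λ β z′)`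
  have eT : ∀ b z, T β z' b z = B β z' b z + dz (lam β z') b z := fun b z => by
    have h := congrFun (congrFun (congrFun (congrFun hTB β) z') b) z
    simp only [Pi.sub_apply] at h
    linarith
  have hsplit : ∀ μ y,
      linAvgAt (toSite rr) (fun b z => (lam α x' z + lam α x' (z + unitVec b)) * T β z' b z) Lc μ y
          - (lam α x' ((Lc : ℤ) • y + toSite rr) + lam α x' ((Lc : ℤ) • y + toSite rr + (Lc : ℤ) • unitVec μ)) * linAvgAt (toSite rr) (T β z') Lc μ y
        = (linAvgAt (toSite rr) (fun b z => (lam α x' z + lam α x' (z + unitVec b)) * B β z' b z) Lc μ y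
            - (lam α x' ((Lc : ℤ) • y + toSite rr) + lam α x' ((Lc : ℤ) • y + toSite rr + (Lc : ℤ) • unitVec μ)) * linAvgAt (toSite rr) (B β z') Lc μ y)
          + (linAvgAt (toSite rr) (fun b z => (lam α x' z + lam α x' (z + unitVec b)) * dz (lam β z') b z) Lc μ y
            - (lam α x' ((Lc : ℤ) • y + toSite rr) + lam α x' ((Lc : ℤ) • y + toSite rr + (Lc : ℤ) • unitVec μ))
              * linAvgAt (toSite rr) (dz (lam β z')) Lc μ y) := by
    intro μ y
    rw [commutator_eq_sum hrr, commutator_eq_sum hrr, commutator_eq_sum hrr (B := dz (lam β z')), ← Finset.sum_add_distrib]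
    refine Finset.sum_congr rfl fun x _ => ?_
    rw [← Finset.sum_add_distrib]
    refine Finset.sum_congr rfl fun a _ => ?_
    rw [eT a x]; ring
  -- the three cells
  obtain ⟨hs1, hb1⟩ := abs_sum_tsum_mixed_le (xg := x') (xl := z') hLc hrr hκ hαg hKB hTb (hψ α x') (hG α x') (fun a x => hB β z' a x) (hbr κ' u')
  obtain ⟨hs2, hb2⟩ := abs_sum_tsum_dz_le (xg := x') (xl := z') hLc hrr hκ hαg hTb (hψ α x') (hψ β z') (hG α x') (hG β z') (hbr κ' u')
  obtain ⟨hs3, hb3⟩ := abs_sum_tsum_mixed_le (xg := z') (xl := x') hLc hrr hκ hαg hKB hTb (hψ β z') (hG β z') (fun a x => hB α x' a x) (hbr κ' u')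
  rw [add_comm (supNorm (z' - u')) (supNorm (x' - u'))] at hb3
  -- the first cell's (μ,y)-sum splits
  have hL : (∑ μ, ∑' y : Site (d + 1), (∑' u, ∑ κ, T κ' u' κ u * c μ y κ u) *
        (linAvgAt (toSite rr) (fun b z => (lam α x' z + lam α x' (z + unitVec b)) * T β z' b z) Lc μ y
          - (lam α x' ((Lc : ℤ) • y + toSite rr) + lam α x' ((Lc : ℤ) • y + toSite rr + (Lc : ℤ) • unitVec μ)) * linAvgAt (toSite rr) (T β z') Lc μ y))
      = (∑ μ, ∑' y : Site (d + 1), (∑' u, ∑ κ, T κ' u' κ u * c μ y κ u) *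
          (linAvgAt (toSite rr) (fun b z => (lam α x' z + lam α x' (z + unitVec b)) * B β z' b z) Lc μ y
            - (lam α x' ((Lc : ℤ) • y + toSite rr) + lam α x' ((Lc : ℤ) • y + toSite rr + (Lc : ℤ) • unitVec μ)) * linAvgAt (toSite rr) (B β z') Lc μ y))
        + (∑ μ, ∑' y : Site (d + 1), (∑' u, ∑ κ, T κ' u' κ u * c μ y κ u) *
          (linAvgAt (toSite rr) (fun b z => (lam α x' z + lam α x' (z + unitVec b)) * dz (lam β z') b z) Lc μ y
            - (lam α x' ((Lc : ℤ) • y + toSite rr) + lam α x' ((Lc : ℤ) • y + toSite rr + (Lc : ℤ) • unitVec μ))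
              * linAvgAt (toSite rr) (dz (lam β z')) Lc μ y)) := by
    rw [← Finset.sum_add_distrib]
    refine Finset.sum_congr rfl fun μ _ => ?_
    rw [← (hs1 μ).tsum_add (hs2 μ)]
    refine tsum_congr fun y => ?_
    rw [hsplit μ y]; ring
  rw [hL]
  -- combine: `|−w(A₁ + A₂) + w A₃| ≤ w(|A₃| + |A₁| + |A₂|)`
  have hw : 0 ≤ (2 * (Lc : ℝ) ^ (d + 1))⁻¹ := by positivity
  have e : ∀ A1 A2 A3 : ℝ, -(2 * (Lc : ℝ) ^ (d + 1))⁻¹ * (A1 + A2) - -(2 * (Lc : ℝ) ^ (d + 1))⁻¹ * A3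
      = (2 * (Lc : ℝ) ^ (d + 1))⁻¹ * (A3 - (A1 + A2)) := fun _ _ _ => by ring
  rw [e, abs_mul, abs_of_nonneg hw]
  refine (mul_le_mul_of_nonneg_left ((abs_sub _ _).trans (add_le_add hb3 ((abs_add_le _ _).trans (add_le_add hb1 hb2)))) hw).trans
    (le_of_eq ?_)
  ring

end Entry

end Summit.QuantumFields.BalabanUV.Beta.GAN24.ContactLambdaEntryBound

end
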